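import Summits.CriticalPhenomena.CardyFormulaZ2.Theorems.CardySusyWardParafermionFamiliesToSLESixWiredOrbitEmpty

/-!
# The concrete anchor family (skeleton r4 of line `strip-anchored-vertex-normalisation`,
# crux stmt-CriticalPhenomena-10814), VIII: the ABSOLUTE phases of the lower-left WIRED swing corners

Registered sub-goal `stub_anchorWiredPhaseLL` of the stub `stub_anchorMoment_of_IP`. For the concrete anchor
data `E = anchorData δ` at level `L` (`L δ < 2 ≤ (L + 1) δ`; `s = v₀ + v₁`, `d = v₀ - v₁`; the sites with
`s ∈ {-(L - 1), -L}` form the lower-left side of the wired arc `A`, `…AnchorDataLattice.lean`), every boundary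
face `F` of that side (`s(F) = -L`, `|d(F)| ≤ L - 5`; corners `F`, `F + e₀`, `F + e₁` on `A`, `F + e₀ + e₁`
inside) is swung around CLOCKWISE by the exploration whenever it is visited: the entering dart `(F + e₀, 1)`
(from the layer edge `s(F + e₀, F + e₀ + e₁)` to the frozen-open `A`–`A` edge `s(F + e₀, F)`), the dart
`(F, 0)` between the two frozen-open sides of `F`, and the leaving dart `(F + e₁, 3)` (back to the layer edge
`s(F + e₁, F + e₀ + e₁)`) come together, with turn counts `t, t - 1, t - 2` (`swing_fwd`, `pred_mid`,
`pred_out`). The two corner observables at `F` are therefore `G(F + e₀, F) = sixthPhase (-1) · P(swing at F)`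
and `G(F + e₁, F) = sixthPhase (-3) · P(swing at F)`:

* ABSOLUTE anchoring (`…WiredOrbitEmpty.lean`): the all-closed exploration hugs the wired arc and visits
  every `(F, 0)` of the side with turn count `-2` (`AnchorWiredEmpty.orbit_LL_of_abs`);
* the wired TouchPhase `WiredTouch.turnCount_visit_const` (`…WiredTouch.lean`) transfers `-2` to every visit
  of `(F, 0)` in every configuration, hence `-1` to every visit of the entering dart and `-3` to every visit
  of the leaving dart; `WiredTouch.cornerObs_eq_of_visit_iff` evaluates both corners on the common event
  `{(F, 0) is visited}`.
-/

noncomputable section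

namespace Summit.CriticalPhenomena.CardyFormulaZ2.Theorems.ParafermionFamiliesToSLESix.StripAnchored

open MeasureTheory Filter Set Metric
open scoped Topology BigOperators
open Literature.Probability.LatticeModels
open Literature.Probability.Percolation (bondPercolation half BondConfig)
open Literature.Probability.RandomPlanarGeometry (DobrushinDomain)
open Summit.CriticalPhenomena.CardyFormulaZ2.Theorems.ParafermionPrecompact.Negative (IsFamily VanishesOn)
open Summit.CriticalPhenomena.CardyFormulaZ2.Cruxes.EdgePrecompact.QkzStripBoundaryArm (cornerObs)
open Literature.Probability.LatticeModels.DiscreteDobrushin (startCorner exitTime isStartCorner_startCorner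
  isInnerFace_of_lt_exitTime not_isInnerFace_exitTime)
open S5 (anchorDomain)
open S2 (sixthPhase)

namespace AnchorWiredLL

variable {δ : ℝ} {L : ℤ}

/-- The faces of the entering and leaving darts of a lower-left face `F`: `cFace (F + e₀, 1) = F` and
`cFace (F + e₁, 3) = F`. [folklore] -/
theorem cFace_in_out (F : Site 2) : cFace (F + cornerUnit 0, 1) = F ∧ cFace (F + cornerUnit 1, 3) = F := by
  constructor <;> ext i <;> fin_cases i <;> simp [cFace, faceAt]

section Level

variable (hδ : 0 < δ) (hLδ : (L : ℝ) * δ < 2) (hL1 : 2 ≤ ((L : ℝ) + 1) * δ) (hL : 4 ≤ L)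
  (hE : (anchorData δ).IsZdAdmissible)
include hδ hLδ hL1 hL

/-! ### The swing around a boundary face, in every configuration -/

/-- **The swing, forward.** If the exploration is at the entering dart `(F + e₀, 1)` of a face `F` of the
lower-left wired side (`s(F) = -L`, `|d(F)| ≤ L - 2`) at time `n < T`, it follows the two frozen-open sides
`s(F + e₀, F)`, `s(F, F + e₁)` of `F`: `orb (n + 1) = (F, 0)`, `orb (n + 2) = (F + e₁, 3)`, `n + 2 < T`,
turn counts `t - 1`, `t - 2`. [cite: Smirnov2001, §2] -/
theorem swing_fwd {F : Site 2} (hs : F 0 + F 1 = -L) (hd : F 0 - F 1 ≤ L - 2) (hd' : -(L - 2) ≤ F 0 - F 1)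
    {ω : BondConfig (Site 2)} {n : ℕ} (hn : n < exitTime hE ω)
    (h : cornerOrbit ((anchorData δ).bcBondConfig ω) (startCorner hE) n = (F + cornerUnit 0, 1)) :
    n + 2 < exitTime hE ω ∧
      cornerOrbit ((anchorData δ).bcBondConfig ω) (startCorner hE) (n + 1) = (F, 0) ∧
      cornerOrbit ((anchorData δ).bcBondConfig ω) (startCorner hE) (n + 2) = (F + cornerUnit 1, 3) ∧
      turnCount ((anchorData δ).bcBondConfig ω) (startCorner hE) (n + 1) =
        turnCount ((anchorData δ).bcBondConfig ω) (startCorner hE) n - 1 ∧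
      turnCount ((anchorData δ).bcBondConfig ω) (startCorner hE) (n + 2) =
        turnCount ((anchorData δ).bcBondConfig ω) (startCorner hE) n - 2 := by
  -- follow `s(F + e₀, F)`
  obtain ⟨hT1, h1, htc1⟩ := AnchorFree.step_open hE (v' := F) (k' := 0) hn h
    (AnchorWired.openA_tgt hδ hLδ hL1 hL _ (by simp; omega) (by simp; omega))
    (by ext i; fin_cases i <;> simp) rfl (AnchorFree.face_of hδ hLδ hL1 (by simp [cFace, faceAt]; omega))
  -- follow `s(F, F + e₁)`
  obtain ⟨hT2, h2, htc2⟩ := AnchorFree.step_open hE (v' := F + cornerUnit 1) (k' := 3) hT1 h1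
    (AnchorWired.openA_tgt hδ hLδ hL1 hL _ (by omega) (by simp; omega))
    (by ext i; fin_cases i <;> simp) rfl (AnchorFree.face_of hδ hLδ hL1 (by simp [cFace, faceAt]; omega))
  exact ⟨hT2, h1, h2, htc1, by rw [htc2, htc1]; ring⟩

/-- **The middle dart is preceded by the entering dart.** A visit `orb n = (F, 0)` of such a face has
`n = n' + 1` with `orb n' = (F + e₀, 1)`: the source edge `s(F, F + e₀)` is frozen open, so the predecessor
is the follow-predecessor (`WiredTouch.orbit_pred_of_mem`; `(F, 0)` is not the start corner `((L-1,1), 2)`).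
[cite: Smirnov2001, §2] -/
theorem pred_mid {F : Site 2} (hs : F 0 + F 1 = -L) (hd : F 0 - F 1 ≤ L - 2) (hd' : -(L - 2) ≤ F 0 - F 1)
    {ω : BondConfig (Site 2)} {n : ℕ}
    (h : cornerOrbit ((anchorData δ).bcBondConfig ω) (startCorner hE) n = (F, 0)) :
    ∃ n', n = n' + 1 ∧ cornerOrbit ((anchorData δ).bcBondConfig ω) (startCorner hE) n' = (F + cornerUnit 0, 1) := by
  have hst := AnchorFree.startCorner_eq hδ hLδ hL1 hL hE
  obtain ⟨j, rfl, hj⟩ := WiredTouch.orbit_pred_of_mem hE (v := F) (k := 0) (by rw [hst]; simp)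
    (AnchorWired.openA_of hδ hLδ hL1 hL (zdGraph_adj_add_cornerUnit F 0) ω (by omega) (by simp; omega)) h
  exact ⟨j, rfl, hj⟩

/-- **The leaving dart is preceded by the middle dart.** A visit `orb n = (F + e₁, 3)` of such a face has
`n = n' + 1` with `orb n' = (F, 0)`: the source edge `s(F + e₁, F)` is frozen open
(`WiredTouch.orbit_pred_of_mem`; `(F + e₁, 3)` is not the start corner). [cite: Smirnov2001, §2] -/
theorem pred_out {F : Site 2} (hs : F 0 + F 1 = -L) (hd : F 0 - F 1 ≤ L - 2) (hd' : -(L - 2) ≤ F 0 - F 1)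
    {ω : BondConfig (Site 2)} {n : ℕ}
    (h : cornerOrbit ((anchorData δ).bcBondConfig ω) (startCorner hE) n = (F + cornerUnit 1, 3)) :
    ∃ n', n = n' + 1 ∧ cornerOrbit ((anchorData δ).bcBondConfig ω) (startCorner hE) n' = (F, 0) := by
  have hst := AnchorFree.startCorner_eq hδ hLδ hL1 hL hE
  obtain ⟨j, rfl, hj⟩ := WiredTouch.orbit_pred_of_mem hE (v := F + cornerUnit 1) (k := 3) (by rw [hst]; simp)
    (AnchorWired.openA_of hδ hLδ hL1 hL (zdGraph_adj_add_cornerUnit _ 3) ω (by simp; omega) (by simp; omega)) h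
  have hF : F + cornerUnit 1 + cornerUnit 3 = F := by
    ext i; fin_cases i <;> simp
  refine ⟨j, rfl, ?_⟩
  rw [hj, hF]
  rfl

/-! ### The two corner observables at a face of the side -/

include hE in
/-- **The absolute wired phases of the lower-left side at level `L`.** For every face `F` with
`s(F) = -L`, `|d(F)| ≤ L - 5` of the anchor data: `G(F + e₀, F) = sixthPhase (-1) · P` and
`G(F + e₁, F) = sixthPhase (-3) · P`, `P` the probability that the exploration visits the middle dart `(F, 0)`
(= swings around `F`). The all-closed visit of `(F, 0)` has turn count `-2` (`AnchorWiredEmpty.orbit_LL_of_abs`);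
the wired TouchPhase (`WiredTouch.turnCount_visit_const`, hole-free inner faces by `holeFree_innerFaces`)
transfers `-2` to every visit of `(F, 0)`, and the swing (`swing_fwd`, `pred_mid`, `pred_out`) makes the
entering, resp. leaving, dart visited exactly when `(F, 0)` is, one step earlier with turn count `-1`, resp.
one step later with turn count `-3`; `WiredTouch.cornerObs_eq_of_visit_iff` evaluates both.
[cite: DuminilCopin2012Parafermion, Proposition 5] -/
theorem wiredPhaseLL_of_level {F : Site 2} (hs : F 0 + F 1 = -L) (hd : |F 0 - F 1| ≤ L - 5) :
    cornerObs (anchorData δ) δ (F + cornerUnit 0) F = sixthPhase (-1) *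
        (((bondPercolation (zdGraph 2) half).real
          {ω : BondConfig (Site 2) | ∃ n < exitTime hE ω,
            cornerOrbit ((anchorData δ).bcBondConfig ω) (startCorner hE) n = (F, 0)} : ℝ) : ℂ) ∧
      cornerObs (anchorData δ) δ (F + cornerUnit 1) F = sixthPhase (-3) *
        (((bondPercolation (zdGraph 2) half).real
          {ω : BondConfig (Site 2) | ∃ n < exitTime hE ω,
            cornerOrbit ((anchorData δ).bcBondConfig ω) (startCorner hE) n = (F, 0)} : ℝ) : ℂ) := by
  have hd2 : |F 0 - F 1| ≤ L - 2 := hd.trans (by omega)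
  rw [abs_le] at hd
  have hH : HoleFree {f : Site 2 | (anchorData δ).IsInnerFace f} :=
    holeFree_innerFaces anchorDomain.toJordanDomain rfl hδ
  -- the all-closed visit of `(F, 0)`, with turn count `-2`
  obtain ⟨n₀, hn₀, h₀, htc₀⟩ := AnchorWiredEmpty.orbit_LL_of_abs hδ hLδ hL1 hL hE hs hd2
  have hA : F ∈ (anchorData δ).zdArcA := AnchorWired.memA_of hδ hLδ hL1 hL (by omega)
  -- wired TouchPhase: every visit of `(F, 0)` has turn count `-2`
  have hτ : ∀ (ω : BondConfig (Site 2)) (n : ℕ), n < exitTime hE ω →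
      cornerOrbit ((anchorData δ).bcBondConfig ω) (startCorner hE) n = (F, 0) →
      turnCount ((anchorData δ).bcBondConfig ω) (startCorner hE) n = -2 :=
    WiredTouch.turnCount_visit_const hE hH (c := (F, 0)) hA hn₀ h₀ htc₀
  obtain ⟨e1, e3⟩ := cFace_in_out F
  -- the entering dart is visited iff `(F, 0)` is, with turn count `-1`
  have hiff₁ : ∀ ω : BondConfig (Site 2),
      (∃ j < exitTime hE ω, cornerOrbit ((anchorData δ).bcBondConfig ω) (startCorner hE) j = (F + cornerUnit 0, 1)) ↔
      ∃ n < exitTime hE ω, cornerOrbit ((anchorData δ).bcBondConfig ω) (startCorner hE) n = (F, 0) := by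
    intro ω
    constructor
    · rintro ⟨j, hj, hjr⟩
      obtain ⟨hj2, h1, -, -, -⟩ := swing_fwd hδ hLδ hL1 hL hE hs (by omega) (by omega) hj hjr
      exact ⟨j + 1, by omega, h1⟩
    · rintro ⟨n, hn, hnr⟩
      obtain ⟨n', rfl, hn'⟩ := pred_mid hδ hLδ hL1 hL hE hs (by omega) (by omega) hnr
      exact ⟨n', by omega, hn'⟩
  have hτ₁ : ∀ (ω : BondConfig (Site 2)) (j : ℕ), j < exitTime hE ω →
      cornerOrbit ((anchorData δ).bcBondConfig ω) (startCorner hE) j = (F + cornerUnit 0, 1) →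
      turnCount ((anchorData δ).bcBondConfig ω) (startCorner hE) j = -1 := by
    intro ω j hj hjr
    obtain ⟨hj2, h1, -, htc1, -⟩ := swing_fwd hδ hLδ hL1 hL hE hs (by omega) (by omega) hj hjr
    have := hτ ω (j + 1) (by omega) h1
    omega
  -- the leaving dart is visited iff `(F, 0)` is, with turn count `-3`
  have hiff₃ : ∀ ω : BondConfig (Site 2),
      (∃ j < exitTime hE ω, cornerOrbit ((anchorData δ).bcBondConfig ω) (startCorner hE) j = (F + cornerUnit 1, 3)) ↔
      ∃ n < exitTime hE ω, cornerOrbit ((anchorData δ).bcBondConfig ω) (startCorner hE) n = (F, 0) := by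
    intro ω
    constructor
    · rintro ⟨j, hj, hjr⟩
      obtain ⟨j', rfl, hj'⟩ := pred_out hδ hLδ hL1 hL hE hs (by omega) (by omega) hjr
      exact ⟨j', by omega, hj'⟩
    · rintro ⟨n, hn, hnr⟩
      obtain ⟨n', rfl, hn'⟩ := pred_mid hδ hLδ hL1 hL hE hs (by omega) (by omega) hnr
      obtain ⟨hn2, -, h2, -, -⟩ := swing_fwd hδ hLδ hL1 hL hE hs (by omega) (by omega) (by omega) hn'
      exact ⟨n' + 2, hn2, h2⟩
  have hτ₃ : ∀ (ω : BondConfig (Site 2)) (j : ℕ), j < exitTime hE ω →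
      cornerOrbit ((anchorData δ).bcBondConfig ω) (startCorner hE) j = (F + cornerUnit 1, 3) →
      turnCount ((anchorData δ).bcBondConfig ω) (startCorner hE) j = -3 := by
    intro ω j hj hjr
    obtain ⟨j', rfl, hj'⟩ := pred_out hδ hLδ hL1 hL hE hs (by omega) (by omega) hjr
    obtain ⟨j'', rfl, hj''⟩ := pred_mid hδ hLδ hL1 hL hE hs (by omega) (by omega) hj'
    obtain ⟨-, h1, -, htc1, htc2⟩ := swing_fwd hδ hLδ hL1 hL hE hs (by omega) (by omega) (by omega) hj''
    have := hτ ω (j'' + 1) (by omega) h1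
    rw [show j'' + 1 + 1 = j'' + 2 by ring, htc2]
    omega
  exact ⟨WiredTouch.cornerObs_eq_of_visit_iff hE (r := (F + cornerUnit 0, 1)) rfl e1 F (-1) hiff₁ hτ₁,
    WiredTouch.cornerObs_eq_of_visit_iff hE (r := (F + cornerUnit 1, 3)) rfl e3 F (-3) hiff₃ hτ₃⟩

end Level

end AnchorWiredLL

/-- **Registered sub-goal `stub_anchorWiredPhaseLL`** (of the stub `stub_anchorMoment_of_IP`, line
`strip-anchored-vertex-normalisation`, skeleton r4): for `0 < δ ≤ 1/8` there is a level `L`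
(`L δ < 2 ≤ (L + 1) δ`) such that every face `F` of the lower-left wired side of the concrete anchor data
`anchorData δ` (`F₀ + F₁ = -L`, `|F₀ - F₁| ≤ L - 5`) has the ABSOLUTE corner phases
`G(F + e₀, F) = sixthPhase (-1) · P`, `G(F + e₁, F) = sixthPhase (-3) · P` with one `P ≥ 0` (the probability
that the exploration swings around `F`). [cite: DuminilCopin2012Parafermion, Proposition 5] -/
theorem stub_anchorWiredPhaseLL : ∀ δ : ℝ, 0 < δ → δ ≤ 1 / 8 → ∃ L : ℤ, (L : ℝ) * δ < 2 ∧ 2 ≤ ((L : ℝ) + 1) * δ ∧ ∀ F : Site 2, F 0 + F 1 = -L → |F 0 - F 1| ≤ L - 5 → ∃ P : ℝ, 0 ≤ P ∧ cornerObs (anchorData δ) δ (F + cornerUnit 0) F = sixthPhase (-1) * (P : ℂ) ∧ cornerObs (anchorData δ) δ (F + cornerUnit 1) F = sixthPhase (-3) * (P : ℂ) := by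
  intro δ hδ hδ8
  obtain ⟨L, hL7, hLδ, hL1⟩ := AnchorLattice.exists_level hδ (hδ8.trans (by norm_num))
  exact ⟨L, hLδ, hL1, fun F hs hd => ⟨_, measureReal_nonneg,
    AnchorWiredLL.wiredPhaseLL_of_level hδ hLδ hL1 (by omega) (AnchorLattice.isZdAdmissible hδ hLδ hL1 (by omega))
      hs hd⟩⟩

end Summit.CriticalPhenomena.CardyFormulaZ2.Theorems.ParafermionFamiliesToSLESix.StripAnchored

end
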